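import Mathlib
import HarnessLib
import Summits.HubbardSuperconductivity.HubbardSuperconductivity.Theorems.KLProgrammeKLRegimeEngineV8E5PointAugmentOverlap
import Summits.HubbardSuperconductivity.HubbardSuperconductivity.Theorems.KLProgrammeH10TwoPointLimitOverlapKernelCharSum

/-!
# Route `KLProgramme` — ENGINE child gen 8 (stmt-HubbardSuperconductivity-20437 `KLRegimeEngineV17F2`), SKELETON v2 class #3, (RA-U)₀ SUPPLIER part 4,
# input 3 at the FIRST STEPS `n ≤ 2`: the overlap rows of the trivial pair `E(1)·S(1)` are EXACTLY `ε⁻¹ = 2M/β`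
# (cell gate-hubbard-kl, seat p5 g14; memo HOME/prover-p5/g11/RA-U-SUPPLY-g11.md §7.2 «n ≤ 2 everything through trivialMultiplier», §7.3 item 3)

For the (RA-U)₀ steps `n ≤ 2` the carrier doors with the trivial input pair (`carrier_*_trivial_le`, …E5CarrierDoorsTrivialInput) are read at the trivial
OUTPUT family too (`E5CarrierLawTrivAt`: `hubbardSectorKernelNorm … (trivialMultiplier L M) …`), so their Young constants `hrow′/hcol′` are the row and column sums
of `E(trivialMultiplier)·S(trivialMultiplier)`.  By plane-wave orthogonality on the space-time torus (p4's character dictionary `rowSum_overlapKernel_eq` /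
`colSum_overlapKernel_eq`, …H10TwoPointLimitOverlapKernelCharSum, with the constant symbol `1`, and `sum_torusChar_left` on the time and space dual tori) this
matrix is `ε⁻¹·δ_{x″x′}·[σ″ = σ′, c″ = c′]`:

* `sum_prodTorusChar_eq` — `Σ_q χ_{q₁}(z₁)χ_{q₂}(z₂) = [z = 0]·(2M)·L²`; `sum_norm_sum_prodTorusChar_eq` — `Σ_z ‖…‖ = 2M·L²`;
* **`rowSum_overlap_trivial_eq`** / **`colSum_overlap_trivial_eq`** — every row sum and every column sum of `E(1)·S(1)` EQUALS `(imagTimeWeight β M)⁻¹`;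
* **`overlapRows_trivial_trivial`** — the `hrow′/hcol′` pair of the (RA-U)₀ doors with `cr = cc = (imagTimeWeight β M)⁻¹` (`= 2M/β`), any `β > 0`, any `L, M`.

Everything is proved; no definitions; no named facts; nothing about the model's sizes is asserted; nothing asserts superconductivity.
[cite: BenfattoGiulianiMastropietro2006, §2.1 (2.5), §2.7 (2.71a)]
-/

noncomputable section

namespace Summit.HubbardSuperconductivity.HubbardSuperconductivity.Theorems.KLRegimeSplit

set_option linter.dupNamespace false -- summit = problem name (single-conjunct summit), D-0017

open Real Finset Literature.MathematicalPhysics.QuantumLattice Literature.Probability.LatticeModels Matrix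
open Summit.HubbardSuperconductivity.HubbardSuperconductivity.Theorems.KLRegimeWick
open Summit.HubbardSuperconductivity.HubbardSuperconductivity.Theorems.TorusFourierL2

variable {L M : ℕ} [NeZero L] [NeZero M]

omit [NeZero L] [NeZero M] in
/-- **Character orthogonality on the space-time dual torus**: `Σ_q χ_{q₁}(z₁)·χ_{q₂}(z₂) = [z₁ = 0]·(2M) · [z₂ = 0]·L²`. [folklore] -/
theorem sum_prodTorusChar_eq [NeZero (2 * M)] [NeZero L] (z : TorusSite 1 (2 * M) × TorusSite 2 L) :
    ∑ q : TorusSite 1 (2 * M) × TorusSite 2 L, torusChar q.1 z.1 * torusChar q.2 z.2 =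
      (if z.1 = 0 then (((2 * M : ℕ) : ℂ)) ^ 1 else 0) * (if z.2 = 0 then (L : ℂ) ^ 2 else 0) := by
  rw [Fintype.sum_prod_type, ← sum_torusChar_left z.1, ← sum_torusChar_left z.2, sum_mul_sum]

omit [NeZero L] [NeZero M] in
/-- `Σ_z ‖Σ_q χ_{q₁}(z₁)χ_{q₂}(z₂) • 1‖ = 2M·L²` (only `z = 0` contributes). [folklore] -/
theorem sum_norm_sum_prodTorusChar_eq [NeZero (2 * M)] [NeZero L] :
    ∑ z : TorusSite 1 (2 * M) × TorusSite 2 L, ‖∑ q : TorusSite 1 (2 * M) × TorusSite 2 L, (torusChar q.1 z.1 * torusChar q.2 z.2) • (1 : ℂ)‖ =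
      ((2 * M : ℕ) : ℝ) * (L : ℝ) ^ 2 := by
  simp_rw [smul_eq_mul, mul_one, sum_prodTorusChar_eq]
  rw [Fintype.sum_eq_single ((0 : TorusSite 1 (2 * M)), (0 : TorusSite 2 L)) fun z hz => ?_]
  · simp
  · have h : ¬(z.1 = 0 ∧ z.2 = 0) := fun h => hz (Prod.ext h.1 h.2)
    by_cases h1 : z.1 = 0
    · rw [if_neg (fun h2 => h ⟨h1, h2⟩), mul_zero, norm_zero]
    · rw [if_neg h1, zero_mul, norm_zero]

/-- **Per-label row sums of `E(1)·S(1)` are `ε⁻¹`**: `Σ_{x′} ‖(E(1)S(1))((x″,(0,σ,c)),(x′,(0,σ,c)))‖ = (imagTimeWeight β M)⁻¹`.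
[cite: BenfattoGiulianiMastropietro2006, §2.1 (2.5)] -/
theorem rowSum_overlap_trivial_label_eq {β : ℝ} (hβ : 0 < β) (σ c : Fin 2) (x'' : SpaceTimeIdx L M) :
    ∑ x' : SpaceTimeIdx L M, ‖(sectorAnalysisMatrix L M β (trivialMultiplier L M) * sectorSubMatrix L M β (trivialMultiplier L M))
        (x'', (((0 : Fin 1), σ), c)) (x', (((0 : Fin 1), σ), c))‖ = (imagTimeWeight β M)⁻¹ := by
  rw [rowSum_overlapKernel_eq hβ]
  simp only [trivialMultiplier, mul_one]
  rw [sum_norm_sum_prodTorusChar_eq, imagTimeWeight, inv_div]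
  have hL : (L : ℝ) ≠ 0 := Nat.cast_ne_zero.2 (NeZero.ne L)
  push_cast
  field_simp

/-- **Per-label column sums of `E(1)·S(1)` are `ε⁻¹`.** [cite: BenfattoGiulianiMastropietro2006, §2.1 (2.5)] -/
theorem colSum_overlap_trivial_label_eq {β : ℝ} (hβ : 0 < β) (σ c : Fin 2) (x' : SpaceTimeIdx L M) :
    ∑ x'' : SpaceTimeIdx L M, ‖(sectorAnalysisMatrix L M β (trivialMultiplier L M) * sectorSubMatrix L M β (trivialMultiplier L M))
        (x'', (((0 : Fin 1), σ), c)) (x', (((0 : Fin 1), σ), c))‖ = (imagTimeWeight β M)⁻¹ := by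
  rw [colSum_overlapKernel_eq hβ]
  simp only [trivialMultiplier, mul_one]
  rw [sum_norm_sum_prodTorusChar_eq, imagTimeWeight, inv_div]
  have hL : (L : ℝ) ≠ 0 := Nat.cast_ne_zero.2 (NeZero.ne L)
  push_cast
  field_simp

/-- **ROW SUMS of `E(trivialMultiplier)·S(trivialMultiplier)` EQUAL `ε⁻¹`** (the spin/charge-off-diagonal entries vanish, the single sector is `0 : Fin 1`).
[cite: BenfattoGiulianiMastropietro2006, §2.7 (2.71a)] -/
theorem rowSum_overlap_trivial_eq {β : ℝ} (hβ : 0 < β) (X'' : SpaceTimeIdx L M × SectorLeg 1) :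
    ∑ X' : SpaceTimeIdx L M × SectorLeg 1,
        ‖(sectorAnalysisMatrix L M β (trivialMultiplier L M) * sectorSubMatrix L M β (trivialMultiplier L M)) X'' X'‖ = (imagTimeWeight β M)⁻¹ := by
  obtain ⟨x'', ⟨⟨ω'', σ⟩, c⟩⟩ := X''
  obtain rfl : ω'' = 0 := Subsingleton.elim _ _
  rw [Fintype.sum_prod_type]
  have hinner : ∀ x' : SpaceTimeIdx L M, ∑ ℓ' : SectorLeg 1,
      ‖(sectorAnalysisMatrix L M β (trivialMultiplier L M) * sectorSubMatrix L M β (trivialMultiplier L M)) (x'', (((0 : Fin 1), σ), c)) (x', ℓ')‖ =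
      ‖(sectorAnalysisMatrix L M β (trivialMultiplier L M) * sectorSubMatrix L M β (trivialMultiplier L M))
        (x'', (((0 : Fin 1), σ), c)) (x', (((0 : Fin 1), σ), c))‖ := by
    intro x'
    rw [Fintype.sum_prod_type, Fintype.sum_prod_type, Fin.sum_univ_one]
    exact sum_spin_charge_eq_single _ σ c fun σ' c' h => by
      rw [sectorAnalysis_mul_sectorSub_apply_of_not β _ _ _ _ (fun h' : σ' = σ ∧ c' = c => h h'), norm_zero]
  simp_rw [hinner]
  exact rowSum_overlap_trivial_label_eq hβ σ c x''

/-- **COLUMN SUMS of `E(trivialMultiplier)·S(trivialMultiplier)` EQUAL `ε⁻¹`.** [cite: BenfattoGiulianiMastropietro2006, §2.7 (2.71a)] -/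
theorem colSum_overlap_trivial_eq {β : ℝ} (hβ : 0 < β) (X' : SpaceTimeIdx L M × SectorLeg 1) :
    ∑ X'' : SpaceTimeIdx L M × SectorLeg 1,
        ‖(sectorAnalysisMatrix L M β (trivialMultiplier L M) * sectorSubMatrix L M β (trivialMultiplier L M)) X'' X'‖ = (imagTimeWeight β M)⁻¹ := by
  obtain ⟨x', ⟨⟨ω', σ⟩, c⟩⟩ := X'
  obtain rfl : ω' = 0 := Subsingleton.elim _ _
  rw [Fintype.sum_prod_type]
  have hinner : ∀ x'' : SpaceTimeIdx L M, ∑ ℓ'' : SectorLeg 1,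
      ‖(sectorAnalysisMatrix L M β (trivialMultiplier L M) * sectorSubMatrix L M β (trivialMultiplier L M)) (x'', ℓ'') (x', (((0 : Fin 1), σ), c))‖ =
      ‖(sectorAnalysisMatrix L M β (trivialMultiplier L M) * sectorSubMatrix L M β (trivialMultiplier L M))
        (x'', (((0 : Fin 1), σ), c)) (x', (((0 : Fin 1), σ), c))‖ := by
    intro x''
    rw [Fintype.sum_prod_type, Fintype.sum_prod_type, Fin.sum_univ_one]
    exact sum_spin_charge_eq_single _ σ c fun σ'' c'' h => by
      rw [sectorAnalysis_mul_sectorSub_apply_of_not β _ _ _ _ (fun h' : σ = σ'' ∧ c = c'' => h ⟨h'.1.symm, h'.2.symm⟩), norm_zero]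
  simp_rw [hinner]
  exact colSum_overlap_trivial_label_eq hβ σ c x'

/-- **`hrow′/hcol′` OF THE (RA-U)₀ DOORS** (steps `n ≤ 2`, trivial input AND output family): `cr = cc = (imagTimeWeight β M)⁻¹ = 2M/β`.
[cite: BenfattoGiulianiMastropietro2006, §2.7 (2.71a)] -/
theorem overlapRows_trivial_trivial {β : ℝ} (hβ : 0 < β) :
    (∀ X'' : SpaceTimeIdx L M × SectorLeg 1, ∑ X' : SpaceTimeIdx L M × SectorLeg 1,
        ‖(sectorAnalysisMatrix L M β (trivialMultiplier L M) * sectorSubMatrix L M β (trivialMultiplier L M)) X'' X'‖ ≤ (imagTimeWeight β M)⁻¹) ∧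
    (∀ X' : SpaceTimeIdx L M × SectorLeg 1, ∑ X'' : SpaceTimeIdx L M × SectorLeg 1,
        ‖(sectorAnalysisMatrix L M β (trivialMultiplier L M) * sectorSubMatrix L M β (trivialMultiplier L M)) X'' X'‖ ≤ (imagTimeWeight β M)⁻¹) ∧
    0 ≤ (imagTimeWeight β M)⁻¹ ∧ (imagTimeWeight β M)⁻¹ = 2 * (M : ℝ) / β :=
  ⟨fun X'' => (rowSum_overlap_trivial_eq hβ X'').le, fun X' => (colSum_overlap_trivial_eq hβ X').le,
    inv_nonneg.2 (imagTimeWeight_nonneg hβ.le M), by rw [imagTimeWeight, inv_div]⟩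

end Summit.HubbardSuperconductivity.HubbardSuperconductivity.Theorems.KLRegimeSplit

end
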